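import Summits.AtomisticToContinuum.Crystallization.Theorems.FreeSplittingCertificatesStrictSplittingRuleP1ExactFlux

/-!
# `StrictSplittingRule` (stmt-AtomisticToContinuum-12560): the BLOCK (site-pair) enclosure bound behind the collar-flux penalty `Δ` (part 105)

Route `FreeSplittingCertificates`, crux r3 `StrictSplittingRule` (H12⋆ = `stub_coreJointCoercive`), unit b2b-freesplit-B gen 50.
VALUE = the kernel form of the reduction both collar-flux engines use (fluxform + mkflux29, gen 29; fluxdiv50, gen 50; HOME CERT §30, §47):
the near certificate books `−κ(VᵀF₀V + Σ_d Δ_d|V_d|²)` while the kernel's (NC∃′) carries the EXACT flux `p1ExactFluxSum`; the engines certify, for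
every `(a,h)` of the box, per-SITE row bounds `Σ_{d′} ‖(F_exact − F₀)_{dd′}‖_F ≤ Δ_d` on the 3 × 3 site-pair BLOCKS.  Part 47's `quadForm_le_of_enclosure`
is the ENTRYWISE version (penalty `Σ_p (Σ_q R_pq) x_p²` over scalar indices); the block version proved here is what the booked penalty `Δ_d|V_d|²` needs:
* `block_bilin_le` — one block: `Σ_{k,l} E_{kl} a_k b_l ≤ R·(|a|² + |b|²)/2` from `Σ E² ≤ R²` (Cauchy–Schwarz on the product index + AM–GM, no square roots);
* `blockQuadForm_le_of_frob` — block Gershgorin: `Σ_{q,q′}Σ_{k,l} E V V ≤ Σ_q (Σ_{q′} R_{qq′})·|V_q|²` for `R` symmetric;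
* `p1NearFlux_le_of_blockRows` — `p1NearFlux F 0 QF V ≤ p1NearFlux F₀ Δ QF V` from block-row bounds `Σ_{q′} R_{qq′} ≤ Δ_q`;
* `p1ExactFluxSum_le_p1NearFlux_of_blockRows` — (ENC): `p1ExactFluxSum a h p V ≤ p1NearFlux F₀ Δ (vertex set of the collar box) V`.
The numerical hypothesis (the block-row bounds, uniformly on the box) is what the certificates establish OUTSIDE the kernel.  NOT a proof of H12⋆, NOT
summit progress.  [folklore: finite-dimensional Cauchy–Schwarz / Gershgorin bookkeeping]
-/

noncomputable section

open Finset
open scoped BigOperators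

namespace Summit.AtomisticToContinuum.Crystallization.Theorems.StrictSplittingRuleBirth

/-! ## One block -/

/-- **One `κ × κ` block**: if `Σ_{k,l} E_{kl}² ≤ R²` with `0 ≤ R` then `Σ_{k,l} E_{kl}·a_k·b_l ≤ R·(Σ_k a_k² + Σ_l b_l²)/2`
(Cauchy–Schwarz on the product index, then `R²AB ≤ (R(A+B)/2)²`). [folklore] -/
theorem block_bilin_le {κ : Type*} [Fintype κ] (E : κ → κ → ℝ) (R : ℝ) (hR : 0 ≤ R)
    (hE : ∑ k, ∑ l, E k l ^ 2 ≤ R ^ 2) (a b : κ → ℝ) :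
    ∑ k, ∑ l, E k l * (a k * b l) ≤ R * ((∑ k, a k ^ 2) + ∑ l, b l ^ 2) / 2 := by
  have hA : 0 ≤ ∑ k, a k ^ 2 := sum_nonneg fun _ _ => sq_nonneg _
  have hB : 0 ≤ ∑ l, b l ^ 2 := sum_nonneg fun _ _ => sq_nonneg _
  have hcs : (∑ kl : κ × κ, E kl.1 kl.2 * (a kl.1 * b kl.2)) ^ 2 ≤
      (∑ kl : κ × κ, E kl.1 kl.2 ^ 2) * ∑ kl : κ × κ, (a kl.1 * b kl.2) ^ 2 :=
    Finset.sum_mul_sq_le_sq_mul_sq _ _ _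
  have h1 : ∑ kl : κ × κ, E kl.1 kl.2 * (a kl.1 * b kl.2) = ∑ k, ∑ l, E k l * (a k * b l) := by
    rw [Fintype.sum_prod_type]
  have h2 : ∑ kl : κ × κ, E kl.1 kl.2 ^ 2 = ∑ k, ∑ l, E k l ^ 2 := by
    rw [Fintype.sum_prod_type]
  have h3 : ∑ kl : κ × κ, (a kl.1 * b kl.2) ^ 2 = (∑ k, a k ^ 2) * ∑ l, b l ^ 2 := by
    rw [Fintype.sum_prod_type, Finset.sum_mul_sum]
    exact Finset.sum_congr rfl fun k _ => Finset.sum_congr rfl fun l _ => by ring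
  rw [h1, h2, h3] at hcs
  set x := ∑ k, ∑ l, E k l * (a k * b l) with hx
  set A := ∑ k, a k ^ 2 with hAdef
  set B := ∑ l, b l ^ 2 with hBdef
  have h4 : x ^ 2 ≤ R ^ 2 * (A * B) :=
    hcs.trans (mul_le_mul_of_nonneg_right hE (mul_nonneg hA hB))
  have h5 : R ^ 2 * (A * B) ≤ (R * (A + B) / 2) ^ 2 := by
    have hsq : 0 ≤ R ^ 2 := sq_nonneg R
    nlinarith [sq_nonneg (A - B), mul_nonneg hsq (sq_nonneg (A - B))]
  have h6 : 0 ≤ R * (A + B) / 2 := by positivity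
  have h7 : |x| ≤ R * (A + B) / 2 := abs_le_of_sq_le_sq (h4.trans h5) h6
  exact (le_abs_self x).trans h7

/-! ## Block Gershgorin -/

/-- **Block Gershgorin bound**: a site-pair block matrix `E` on a finite site set `QF` whose blocks satisfy `Σ_{k,l} E_{(q,k),(q′,l)}² ≤ R_{qq′}²`
with `R ≥ 0` symmetric has `Σ_{q,q′∈QF} Σ_{k,l} E·V_{qk}V_{q′l} ≤ Σ_{q∈QF} (Σ_{q′∈QF} R_{qq′})·Σ_k V_{qk}²`. [folklore] -/
theorem blockQuadForm_le_of_frob {σ κ : Type*} [Fintype κ] (QF : Finset σ) (E : σ × κ → σ × κ → ℝ) (R : σ → σ → ℝ)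
    (hR0 : ∀ q q', 0 ≤ R q q') (hRs : ∀ q q', R q q' = R q' q)
    (hE : ∀ q ∈ QF, ∀ q' ∈ QF, ∑ k, ∑ l, E (q, k) (q', l) ^ 2 ≤ R q q' ^ 2) (V : σ → κ → ℝ) :
    ∑ q ∈ QF, ∑ q' ∈ QF, ∑ k, ∑ l, E (q, k) (q', l) * (V q k * V q' l) ≤
      ∑ q ∈ QF, (∑ q' ∈ QF, R q q') * ∑ k, V q k ^ 2 := by
  have h1 : ∑ q ∈ QF, ∑ q' ∈ QF, ∑ k, ∑ l, E (q, k) (q', l) * (V q k * V q' l) ≤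
      ∑ q ∈ QF, ∑ q' ∈ QF, R q q' * ((∑ k, V q k ^ 2) + ∑ k, V q' k ^ 2) / 2 :=
    sum_le_sum fun q hq => sum_le_sum fun q' hq' =>
      block_bilin_le (fun k l => E (q, k) (q', l)) (R q q') (hR0 q q') (hE q hq q' hq') (V q) (V q')
  refine h1.trans (le_of_eq ?_)
  have e1 : ∀ q q', R q q' * ((∑ k, V q k ^ 2) + ∑ k, V q' k ^ 2) / 2 =
      R q q' * (∑ k, V q k ^ 2) / 2 + R q q' * (∑ k, V q' k ^ 2) / 2 := fun q q' => by ring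
  simp_rw [e1, sum_add_distrib]
  have e2 : ∑ q ∈ QF, ∑ q' ∈ QF, R q q' * (∑ k, V q' k ^ 2) / 2 = ∑ q ∈ QF, ∑ q' ∈ QF, R q q' * (∑ k, V q k ^ 2) / 2 := by
    rw [sum_comm]
    exact sum_congr rfl fun q _ => sum_congr rfl fun q' _ => by rw [hRs q' q]
  rw [e2, ← sum_add_distrib]
  refine sum_congr rfl fun q _ => ?_
  rw [← sum_add_distrib, sum_mul]
  exact sum_congr rfl fun q' _ => by ring

/-! ## The flux-enclosure form -/

/-- `fpSq` of a lattice value as a `Fin 3`-sum of squared components. [folklore] -/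
theorem fpSq_eq_finsum_sq (x : Fin 3 → ℝ) : fpSq x = ∑ k : Fin 3, x k ^ 2 := by
  simp only [fpSq, Fin.sum_univ_three]

/-- **Booked form dominates the exact form under block-row bounds**: if the site-pair blocks of `F − F₀` have Frobenius bounds `R` (symmetric, `≥ 0`)
with row sums `Σ_{q′∈QF} R_{qq′} ≤ Δ_q` on `QF`, then `p1NearFlux F 0 QF V ≤ p1NearFlux F₀ Δ QF V` for every `V`
— the inequality behind booking `−κ·(F₀ + Δ)` for `−κ·F`. [folklore] -/
theorem p1NearFlux_le_of_blockRows (F F0 : (ℤ × ℤ × ℤ) × Fin 3 → (ℤ × ℤ × ℤ) × Fin 3 → ℝ) (Δ : (ℤ × ℤ × ℤ) → ℝ)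
    (QF : Finset (ℤ × ℤ × ℤ)) (R : (ℤ × ℤ × ℤ) → (ℤ × ℤ × ℤ) → ℝ)
    (hR0 : ∀ q q', 0 ≤ R q q') (hRs : ∀ q q', R q q' = R q' q)
    (hE : ∀ q ∈ QF, ∀ q' ∈ QF, ∑ k, ∑ l, (F (q, k) (q', l) - F0 (q, k) (q', l)) ^ 2 ≤ R q q' ^ 2)
    (hrow : ∀ q ∈ QF, ∑ q' ∈ QF, R q q' ≤ Δ q) (V : ℤ × ℤ × ℤ → (Fin 3 → ℝ)) :
    p1NearFlux F (fun _ => 0) QF V ≤ p1NearFlux F0 Δ QF V := by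
  have hblk := blockQuadForm_le_of_frob QF (fun x y => F x y - F0 x y) R hR0 hRs hE V
  have hsplit : ∑ q ∈ QF, ∑ q' ∈ QF, ∑ k, ∑ l, F (q, k) (q', l) * (V q k * V q' l) =
      (∑ q ∈ QF, ∑ q' ∈ QF, ∑ k, ∑ l, F0 (q, k) (q', l) * (V q k * V q' l)) +
        ∑ q ∈ QF, ∑ q' ∈ QF, ∑ k, ∑ l, (F (q, k) (q', l) - F0 (q, k) (q', l)) * (V q k * V q' l) := by
    rw [← sum_add_distrib]
    refine sum_congr rfl fun q _ => ?_
    rw [← sum_add_distrib]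
    refine sum_congr rfl fun q' _ => ?_
    rw [← sum_add_distrib]
    refine sum_congr rfl fun k _ => ?_
    rw [← sum_add_distrib]
    exact sum_congr rfl fun l _ => by ring
  have hpen : ∑ q ∈ QF, (∑ q' ∈ QF, R q q') * ∑ k, V q k ^ 2 ≤ ∑ q ∈ QF, Δ q * fpSq (V q) := by
    refine sum_le_sum fun q hq => ?_
    rw [fpSq_eq_finsum_sq]
    exact mul_le_mul_of_nonneg_right (hrow q hq) (sum_nonneg fun _ _ => sq_nonneg _)
  unfold p1NearFlux
  simp only [zero_mul, sum_const_zero, add_zero]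
  rw [hsplit]
  linarith [hblk, hpen]

/-- **(ENC) — the exact collar flux is dominated by the booked enclosure form**: with `QF` the vertex set of the collar box and `F` the scattered exact
per-cell matrices, block-row bounds `Σ_{q′} ‖(F − F₀)_{qq′}‖_F ≤ Δ_q` give `p1ExactFluxSum a h p V ≤ p1NearFlux F₀ Δ QF V` for every `V` — the hypothesis
is what the two collar-flux engines certify (uniformly on the `(a,h)`-box) for the pinned `F₀, Δ`.  NOT a proof of H12⋆, NOT summit progress. [folklore] -/
theorem p1ExactFluxSum_le_p1NearFlux_of_blockRows (a h : ℝ) (p : ℤ × ℤ × ℤ)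
    (F0 : (ℤ × ℤ × ℤ) × Fin 3 → (ℤ × ℤ × ℤ) × Fin 3 → ℝ) (Δ : (ℤ × ℤ × ℤ) → ℝ) (R : (ℤ × ℤ × ℤ) → (ℤ × ℤ × ℤ) → ℝ)
    (hR0 : ∀ q q', 0 ≤ R q q') (hRs : ∀ q q', R q q' = R q' q)
    (hE : ∀ q ∈ p1ScatterQF (p1CollarBox p), ∀ q' ∈ p1ScatterQF (p1CollarBox p),
      ∑ k, ∑ l, (p1ScatterFL0 (p1ExactFluxMat a h p) (p1CollarBox p) (q, k) (q', l) - F0 (q, k) (q', l)) ^ 2 ≤ R q q' ^ 2)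
    (hrow : ∀ q ∈ p1ScatterQF (p1CollarBox p), ∑ q' ∈ p1ScatterQF (p1CollarBox p), R q q' ≤ Δ q)
    (V : ℤ × ℤ × ℤ → (Fin 3 → ℝ)) :
    p1ExactFluxSum a h p V ≤ p1NearFlux F0 Δ (p1ScatterQF (p1CollarBox p)) V := by
  rw [← p1NearFlux_exact]
  exact p1NearFlux_le_of_blockRows _ F0 Δ _ R hR0 hRs hE hrow V

end Summit.AtomisticToContinuum.Crystallization.Theorems.StrictSplittingRuleBirth

end
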